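import Summits.Parity.GeneralizedHardyLittlewood.Theorems.Dhl42DataH40
import Summits.Parity.GeneralizedHardyLittlewood.Theorems.Dhl42DataH41
import Summits.Parity.GeneralizedHardyLittlewood.Theorems.Dhl42DataH42
import Summits.Parity.GeneralizedHardyLittlewood.Theorems.Dhl42DataFI
import Literature.Analysis.ValidatedNumerics.ExpPoly.ToExpSum
import Summits.Parity.GeneralizedHardyLittlewood.Theorems.Dhl42MainTermsData
import Summits.Parity.GeneralizedHardyLittlewood.Theorems.Dhl42ClosedFormSetup

/-!
# DHL[42,2] certificate — kernel verification of the four class pairings of `I(F₀)` and of their total against `iTerms`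

`decide +kernel` evaluations (as in `Dhl42KernelH`): the four `I`-side class pairings of the literal
densities `H40`–`H42` with the weights `Φ²`, `Φχ`, `χ²` of `Dhl42ClosedFormSetup` are the literals
`FI1` … `FI4`, and their total with multiplicities `1, 84, 42, 1722` is, as a normalised formal sum,
the 23-term exact value `iTerms` of `Dhl42MainTermsData` (`Itot`). Kernel time ≈ 15 + 24 + 24 + 5 s.

Origin: `Dhl42/ClosedForm/KernelI.lean` of the DHL[42,2] certificate package (pub-dhl42 bundle,
archive blob `18cce9e3`; sha256[:16] of the file `97fdb8c52491d928`; paper snapshot =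
`paper/main.tex` v1), lines :24–:36; statements and proofs unchanged except: namespace
`Dhl42.ClosedForm` → `Summit.Parity.GeneralizedHardyLittlewood.Theorems.Dhl42.ClosedForm`,
`Dhl42.ExpPoly` → the tree's `Literature.Analysis.ValidatedNumerics.ExpPoly` (`ExpPoly/*.lean`,
batch B1), `Dhl42.ClosedForm.Eterms` → the tree's
`Literature.Analysis.ValidatedNumerics.ExpPoly.ToExpSum` (`etermsFS`, batch B1);
`Dhl42.MainTermsData.*` resolves to
`Summit.Parity.GeneralizedHardyLittlewood.Theorems.Dhl42.MainTermsData.*` unchanged, docstrings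
added where missing (the docstring of `Itot` re-worded for the tree: package-internal pointers
removed, mathematics unchanged).

Declarations (5): `Itot`, `pI1`, `pI2`, `pI3`, `pI4`.
-/

-- `decide +kernel` below: the `Decidable` instances unfold `EP.canon` / `EP.conv` / `FS.norm` structurally over lists of
-- hundreds of blocks with GMP-size rationals (deep recursion), and each kernel evaluation runs for 5–60 s on the package
-- toolchain — heartbeats meter only the elaborator's share, which must not abort a check the kernel completes
set_option maxRecDepth 100000
set_option maxHeartbeats 0

open Literature.Analysis.ValidatedNumerics.ExpPoly

namespace Summit.Parity.GeneralizedHardyLittlewood.Theorems.Dhl42.ClosedForm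

/-- Kernel identity of formal sums: the total of the four `I`-side class pairings with
multiplicities `1, 84, 42, 1722` has the same normal form as the 23-term exact value `iTerms` of
`Dhl42MainTermsData` (converted to `FS` by `etermsFS`). -/
theorem Itot : FS.norm (FI1 ++ FS.smul 84 FI2 ++ FS.smul 42 FI3 ++ FS.smul 1722 FI4) =
    FS.norm (etermsFS Dhl42.MainTermsData.iTerms) := by decide +kernel

/-- Kernel evaluation, `I`-side pairing 1 (class A of `Dhl42MainI`: all 42 factors `G`): the
normalised pairing of the density `H42 = G^{⋆42}` with the weight `Φ²` — `WPhi2lo` on `[0, K]`,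
`WPhi2hi` on `(K, S]` — is the literal `FI1`. -/
theorem pI1 : FS.norm (pairLoHi H42 WPhi2lo WPhi2hi) = FI1 := by decide +kernel

/-- Kernel evaluation, `I`-side pairing 2 (class B: one factor `gh`): the normalised pairing of
`canon (GHE ⋆ H41)` with the weight `Φχ = WPhichi` on `[0, K]` is the literal `FI2`. -/
theorem pI2 : FS.norm (pairLo (EP.canon (EP.conv GHE H41)) WPhichi) = FI2 := by decide +kernel

/-- Kernel evaluation, `I`-side pairing 3 (class C: one factor `h²`): the normalised pairing of
`canon (H2E ⋆ H41)` with the weight `χ² = Wchi2` on `[0, K]` is the literal `FI3`. -/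
theorem pI3 : FS.norm (pairLo (EP.canon (EP.conv H2E H41)) Wchi2) = FI3 := by decide +kernel

/-- Kernel evaluation, `I`-side pairing 4 (class D: two factors `gh`): the normalised pairing of
`canon (GHE ⋆ canon (GHE ⋆ H40))` with the weight `χ² = Wchi2` on `[0, K]` is the literal `FI4`. -/
theorem pI4 : FS.norm (pairLo (EP.canon (EP.conv GHE (EP.canon (EP.conv GHE H40)))) Wchi2) = FI4 := by
  decide +kernel

end Summit.Parity.GeneralizedHardyLittlewood.Theorems.Dhl42.ClosedForm
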